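import Mathlib
import Summits.NavierStokesRegularity.NavierStokesRegularity.Theorems.EulerZoomLiouvillePowerGaugeEulerLiouvilleClassIsometry
import Summits.NavierStokesRegularity.NavierStokesRegularity.Theorems.EulerZoomLiouvillePowerGaugeEulerLiouvilleNeedleAxisymNoSwirlMember
import HarnessLib.Audit

/-!
# Crux E `EulerZoomLiouville.PowerGaugeEulerLiouville` — the axisymmetric swirl-free `C²` needle stratum is empty
# ABOUT EVERY AXIS THROUGH THE BLOW-UP POINT (ROUND-37 (S37) ∘ class isometry transport)

Route №10 `EulerZoomLiouville` (NavierStokesRegularity), crux E = stmt-NavierStokesRegularity-19832, registered residue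
`stub_selfSimilarC2Needle`.  `…NeedleAxisymNoSwirlMember` kills exactly self-similar members whose `C²` profile is
axisymmetric and swirl-free about the FIXED axis `ℝ e₂` of `Literature.Analysis.FluidPDE.IsAxisymmetric`; Seregin's class is
`O(3)`-invariant (`…ClassIsometry`), and the self-similar ansatz commutes with linear isometries, so the stratum dies about
ANY axis through the origin:

* `selfSimilarCollapse_conj` / `selfSimilarCollapsePressure_conj` — the ansatz of the conjugated profile
  `y ↦ R V(R⁻¹ y)` is the conjugated ansatz;
* **`selfSimilar_ae_eq_zero_of_axisymNoSwirlC2_conj`** — crux hypotheses verbatim (`0 < ρ ≤ ½`) + exact self-similarity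
  with profile `(V, P)` + `V ∈ C²` + for SOME linear isometry `R` of `ℝ³` the conjugated profile `y ↦ R V(R⁻¹ y)` is
  axisymmetric and swirl-free ⇒ `u = 0` a.e. on the slab.  Binder for THE ONE STATEMENT:
  `¬ ∃ R : E3 ≃ₗᵢ[ℝ] E3, IsAxisymmetric (fun y => R (V (R.symm y))) ∧ HasNoSwirl (fun y => R (V (R.symm y)))`.

NOT NS, not E; a model-class stratum of THE ONE STATEMENT; 19832 OPEN.
References: Constantin–Ignatova–Vicol arXiv:2602.17570 §3.4–§3.5 [ConstantinIgnatovaVicol2026Putative]; Majda–Bertozzi 2002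
§1.2 Prop. 1.1 (iii) [MajdaBertozziCUP2002].
-/

noncomputable section

-- the summit and its single problem share the name `NavierStokesRegularity` (D-0017 nested layout)
set_option linter.dupNamespace false

open Set Filter Topology Metric Function MeasureTheory InnerProductSpace
open scoped RealInnerProductSpace NNReal ENNReal

namespace Summit.NavierStokesRegularity.NavierStokesRegularity.Theorems.PowerGaugeEulerLiouville.NeedleRace

open Literature.Analysis Literature.Analysis.FluidPDE
open Summit.NavierStokesRegularity.NavierStokesRegularity.Theorems.PowerGaugeEulerLiouville
open Summit.NavierStokesRegularity.NavierStokesRegularity.Theorems.PowerGaugeEulerLiouville.ClassIsometry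
open Summit.NavierStokesRegularity.NavierStokesRegularity.Theorems.PowerGaugeEulerLiouville.PressureSlaving

/-! ### The ansatz commutes with linear isometries -/

/-- `R (selfSimilarCollapse γ 0 V τ (R⁻¹ x)) = selfSimilarCollapse γ 0 (R ∘ V ∘ R⁻¹) τ x`. [folklore] -/
theorem selfSimilarCollapse_conj (R : EuclideanSpace ℝ (Fin 3) ≃ₗᵢ[ℝ] EuclideanSpace ℝ (Fin 3)) (γ τ : ℝ)
    (V : EuclideanSpace ℝ (Fin 3) → EuclideanSpace ℝ (Fin 3)) (x : EuclideanSpace ℝ (Fin 3)) :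
    R (selfSimilarCollapse γ 0 V τ (R.symm x)) = selfSimilarCollapse γ 0 (fun y => R (V (R.symm y))) τ x := by
  simp only [selfSimilarCollapse_apply, map_smul]

/-- `selfSimilarCollapsePressure γ 0 P τ (R⁻¹ x) = selfSimilarCollapsePressure γ 0 (P ∘ R⁻¹) τ x`. [folklore] -/
theorem selfSimilarCollapsePressure_conj (R : EuclideanSpace ℝ (Fin 3) ≃ₗᵢ[ℝ] EuclideanSpace ℝ (Fin 3)) (γ τ : ℝ)
    (P : EuclideanSpace ℝ (Fin 3) → ℝ) (x : EuclideanSpace ℝ (Fin 3)) :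
    selfSimilarCollapsePressure γ 0 P τ (R.symm x) = selfSimilarCollapsePressure γ 0 (fun y => P (R.symm y)) τ x := by
  simp only [selfSimilarCollapsePressure_apply, LinearIsometryEquiv.map_smul]

/-! ### Member level: any axis through the origin -/

/-- **THE AXISYMMETRIC SWIRL-FREE `C²` NEEDLE STRATUM IS EMPTY ABOUT EVERY AXIS THROUGH THE BLOW-UP POINT.**  Crux
hypotheses verbatim (`0 < ρ ≤ ½`) + exact self-similarity about the origin with profile `(V, P)` + `V ∈ C²` + for some linear
isometry `R` of `ℝ³` the conjugated profile `y ↦ R V(R⁻¹ y)` is `IsAxisymmetric` and `HasNoSwirl` ⇒ `u = 0` a.e. on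
`(−∞,0) × ℝ³`.  (Transport the member along `R` by `…ClassIsometry`, kill it by `selfSimilar_ae_eq_zero_of_axisymNoSwirlC2`,
pull the a.e.-vanishing back along the measure-preserving `(s, x) ↦ (s, R x)`.) [cite: ConstantinIgnatovaVicol2026Putative, §3.4.1 eq. (3.21)-(3.22), §3.5] -/
theorem selfSimilar_ae_eq_zero_of_axisymNoSwirlC2_conj {ρ : ℝ} (hρ : 0 < ρ) (hρ1 : ρ ≤ 1 / 2)
    {u : ℝ → EuclideanSpace ℝ (Fin 3) → EuclideanSpace ℝ (Fin 3)} {p : ℝ → EuclideanSpace ℝ (Fin 3) → ℝ}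
    {H : ℝ → EuclideanSpace ℝ (Fin 3) → EuclideanSpace ℝ (Fin 3) →L[ℝ] EuclideanSpace ℝ (Fin 3)} {c : ℝ≥0}
    (hsw : IsSuitableWeakSolutionOn (slab (EuclideanSpace ℝ (Fin 3)) (Iio 0) isOpen_Iio) 0 0 u p)
    (hH : HasWeakSpatialGradientOn (slab (EuclideanSpace ℝ (Fin 3)) (Iio 0) isOpen_Iio) u H)
    (hgauge : ∀ a : ℝ, 0 < a →
      ENNReal.ofReal (a ^ (2 * ρ)) * cknA a (0 : ℝ × EuclideanSpace ℝ (Fin 3)) u +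
          ENNReal.ofReal (a ^ ρ) * cknE a (0 : ℝ × EuclideanSpace ℝ (Fin 3)) H +
        ENNReal.ofReal (a ^ (2 * ρ)) * cknD a (0 : ℝ × EuclideanSpace ℝ (Fin 3)) p ≤ (c : ℝ≥0∞))
    {V : EuclideanSpace ℝ (Fin 3) → EuclideanSpace ℝ (Fin 3)} {P : EuclideanSpace ℝ (Fin 3) → ℝ}
    (hu : ∀ τ : ℝ, τ < 0 → u τ = selfSimilarCollapse (1 / (2 + ρ)) 0 V τ)
    (hp : ∀ τ : ℝ, τ < 0 → p τ = selfSimilarCollapsePressure (1 / (2 + ρ)) 0 P τ)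
    (hV : ContDiff ℝ 2 V) (R : EuclideanSpace ℝ (Fin 3) ≃ₗᵢ[ℝ] EuclideanSpace ℝ (Fin 3))
    (hax : IsAxisymmetric (fun y => R (V (R.symm y)))) (hns : HasNoSwirl (fun y => R (V (R.symm y)))) :
    uncurry u =ᵐ[volume.restrict (Iio (0 : ℝ) ×ˢ (univ : Set (EuclideanSpace ℝ (Fin 3))))] 0 := by
  -- the conjugated member
  have hsw' := isSuitableWeakSolutionOn_conj_isometry isOpen_Iio hsw R
  have hf0 : (fun (s : ℝ) (x : EuclideanSpace ℝ (Fin 3)) =>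
      R ((0 : ℝ → EuclideanSpace ℝ (Fin 3) → EuclideanSpace ℝ (Fin 3)) s (R.symm x))) = 0 := by
    funext s x
    simp
  rw [hf0] at hsw'
  have hH' := hasWeakSpatialGradientOn_conj_isometry isOpen_Iio hH R
  have hgauge' := gauge_conj_isometry R hgauge
  have hu' : ∀ τ : ℝ, τ < 0 → (fun s x => R (u s (R.symm x))) τ =
      selfSimilarCollapse (1 / (2 + ρ)) 0 (fun y => R (V (R.symm y))) τ := by
    intro τ hτ
    funext x
    simp only [hu τ hτ, selfSimilarCollapse_conj]
  have hp' : ∀ τ : ℝ, τ < 0 → (fun s x => p s (R.symm x)) τ =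
      selfSimilarCollapsePressure (1 / (2 + ρ)) 0 (fun y => P (R.symm y)) τ := by
    intro τ hτ
    funext x
    simp only [hp τ hτ, selfSimilarCollapsePressure_conj]
  have hV' : ContDiff ℝ 2 (fun y => R (V (R.symm y))) :=
    R.toContinuousLinearEquiv.contDiff.comp (hV.comp R.symm.toContinuousLinearEquiv.contDiff)
  -- kill the conjugated member
  have h' := selfSimilar_ae_eq_zero_of_axisymNoSwirlC2 hρ hρ1 hsw' hH' hgauge' hu' hp' hV' hax hns
  -- pull the vanishing back along `(s, x) ↦ (s, R x)`
  set Ψ : ℝ × EuclideanSpace ℝ (Fin 3) → ℝ × EuclideanSpace ℝ (Fin 3) := fun z => (z.1, R z.2) with hΨ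
  have hΨmp : MeasurePreserving Ψ
      (volume.restrict (Iio (0 : ℝ) ×ˢ (univ : Set (EuclideanSpace ℝ (Fin 3)))))
      (volume.restrict (Iio (0 : ℝ) ×ˢ (univ : Set (EuclideanSpace ℝ (Fin 3))))) := by
    have h1 := (measurePreserving_prod_isometry R).restrict_preimage_emb (measurableEmbedding_prod_isometry R)
      (Iio (0 : ℝ) ×ˢ (univ : Set (EuclideanSpace ℝ (Fin 3))))
    rwa [preimage_prod_isometry_slab] at h1
  have h2 : ∀ᵐ z ∂(volume.restrict (Iio (0 : ℝ) ×ˢ (univ : Set (EuclideanSpace ℝ (Fin 3))))),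
      uncurry (fun s x => R (u s (R.symm x))) (Ψ z) = (0 : ℝ × EuclideanSpace ℝ (Fin 3) → EuclideanSpace ℝ (Fin 3)) (Ψ z) :=
    hΨmp.quasiMeasurePreserving.tendsto_ae.eventually h'
  filter_upwards [h2] with z hz
  have hz' : R (u z.1 z.2) = 0 := by simpa [hΨ, uncurry] using hz
  show u z.1 z.2 = 0
  simpa using hz'

end Summit.NavierStokesRegularity.NavierStokesRegularity.Theorems.PowerGaugeEulerLiouville.NeedleRace

end
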